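import Mathlib

/-!
# The algebraic core of the IMPROVED pendant step of the `v`-exploration of `(K′)`
(blind cell PercRepro2, mine-c g34; `conjectures/MINE-C.md` §43.1)

`pendant_core_T`: the cleared pendant identity of `MINE-C.md` §43.1 in the variables of
`KPrimePendantCore.lean` — the masses of the `z`-instance with the pendant edge pinned closed —
and the sign of each of its terms.  Compared with `pendant_core` (§42.5) the hypothesis `(K′-Ω+)` of
the `z`-instance is replaced by the WEAKER `(K′-T)` (= `(K′-Ω+)` minus the allowance
`κ P(Ω) (P(Y | Ω) − P(Y | S)) ≥ 0`, `KPrimeLeafMartingale.lean`): the `D`-term of the identity,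
dropped in `pendant_core`, pays for the allowance.  The identity (with `Sv = t Sz + (1−t) O`,
`Nd = t Nz + (1−t) O`, `K = O A − XO Hh`):

  `O Sz Nz · form_v = (1−t) Sz Nz Nd Sv · baseCov + t² O Nz Sv · form_z + t(1−t) Sv Sz Nz · mtForm_z
     + t²(1−t) K Nz Z2O (Sz YO − O YSz)`,

`baseCov = O wXO − wO XO` (van den Berg–Kahn), `form_z` the cleared `(K′)` of the `z`-instance,
`mtForm_z = O² C01e − O XO C01 − O² Cc + O XO Dd + K (wO + YO)` its cleared `(K′-T)`,
`K ≥ 0` (van den Berg–Kahn), `Sz YO − O YSz ≥ 0` (`P(Y | Ω) ≥ P(Y | S_z)`, BHK 1.3).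
-/

namespace Summit.Ventures.PercRepro2

namespace KPrime

variable {R : Type*} [Field R] [LinearOrder R] [IsStrictOrderedRing R]

section PendantCoreT

/-- **The algebraic core of the improved pendant step**: the cleared pendant identity (by `ring`)
and the sign of each term.  Variables as in `pendant_core` (the masses of the `z`-instance with `e`
pinned closed); hypotheses the van den Berg–Kahn inequalities `vC`, `vZ`, `vY`, the complement
decompositions, `(K′)` of the `z`-instance (`H1`) and `(K′-T)` of the `z`-instance (`H2T`, the
cleared `mtForm ≥ 0`). -/
lemma pendant_core_T (t O XO wO wXO YO Sz YSz Nz XNz A Hh C01e C01 Cc Dd Z2O YZ2O : R)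
    (ht0 : 0 ≤ t) (ht1 : t ≤ 1) (hO : 0 < O) (hNz : 0 < Nz) (hSz : 0 < Sz) (hZ2O : 0 ≤ Z2O)
    (vC : XO * wO ≤ wXO * O) (vZ : XO * Hh ≤ A * O) (cN : Hh + Nz = O) (cXN : A + XNz = XO)
    (vY : YO * Z2O ≤ YZ2O * O) (cS : Z2O + Sz = O) (cYS : YZ2O + YSz = YO)
    (H1 : 0 ≤ (A * Nz - XNz * Hh) * YSz + Sz * ((C01e * Nz - XNz * C01) - (Cc * Nz - XNz * Dd)))
    (H2T : 0 ≤ O ^ 2 * C01e - O * XO * C01 - O ^ 2 * Cc + O * XO * Dd +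
      (O * A - XO * Hh) * (wO + YO)) :
    0 ≤ (t * A * (t * Nz + (1 - t) * O) - (t * XNz + (1 - t) * XO) * (t * Hh)) *
          (t * YSz + (1 - t) * YO) +
        (t * Sz + (1 - t) * O) *
          (((t * C01e + (1 - t) * wXO) * (t * Nz + (1 - t) * O) -
              (t * XNz + (1 - t) * XO) * (t * C01 + (1 - t) * wO)) -
            (t * Cc * (t * Nz + (1 - t) * O) - (t * XNz + (1 - t) * XO) * (t * Dd))) := by
  have ht1' : 0 ≤ 1 - t := sub_nonneg.2 ht1
  have hSv : 0 ≤ t * Sz + (1 - t) * O := by positivity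
  have hNd : 0 ≤ t * Nz + (1 - t) * O := by positivity
  have hK : 0 ≤ O * A - XO * Hh := by linarith
  have hbase : 0 ≤ O * wXO - wO * XO := by linarith
  have hD : 0 ≤ Sz * YO - O * YSz := by
    have eZ : Z2O = O - Sz := by linarith
    have eY : YZ2O = YO - YSz := by linarith
    rw [eZ, eY] at vY
    nlinarith [vY]
  -- the cleared identity
  have key : O * Sz * Nz *
      ((t * A * (t * Nz + (1 - t) * O) - (t * XNz + (1 - t) * XO) * (t * Hh)) *
          (t * YSz + (1 - t) * YO) +
        (t * Sz + (1 - t) * O) *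
          (((t * C01e + (1 - t) * wXO) * (t * Nz + (1 - t) * O) -
              (t * XNz + (1 - t) * XO) * (t * C01 + (1 - t) * wO)) -
            (t * Cc * (t * Nz + (1 - t) * O) - (t * XNz + (1 - t) * XO) * (t * Dd)))) =
      (1 - t) * (Sz * Nz) * (t * Nz + (1 - t) * O) * (t * Sz + (1 - t) * O) *
          (O * wXO - wO * XO) +
        t ^ 2 * O * Nz * (t * Sz + (1 - t) * O) *
          ((A * Nz - XNz * Hh) * YSz + Sz * ((C01e * Nz - XNz * C01) - (Cc * Nz - XNz * Dd))) +
        t * (1 - t) * (t * Sz + (1 - t) * O) * (Sz * Nz) *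
          (O ^ 2 * C01e - O * XO * C01 - O ^ 2 * Cc + O * XO * Dd + (O * A - XO * Hh) * (wO + YO)) +
        t ^ 2 * (1 - t) * (O * A - XO * Hh) * Nz * Z2O * (Sz * YO - O * YSz) := by
    have eN : Nz = O - Hh := by linarith
    have eX : XNz = XO - A := by linarith
    have eZ : Z2O = O - Sz := by linarith
    subst eN eX eZ
    ring
  have hrhs : 0 ≤ (1 - t) * (Sz * Nz) * (t * Nz + (1 - t) * O) * (t * Sz + (1 - t) * O) *
          (O * wXO - wO * XO) +
        t ^ 2 * O * Nz * (t * Sz + (1 - t) * O) *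
          ((A * Nz - XNz * Hh) * YSz + Sz * ((C01e * Nz - XNz * C01) - (Cc * Nz - XNz * Dd))) +
        t * (1 - t) * (t * Sz + (1 - t) * O) * (Sz * Nz) *
          (O ^ 2 * C01e - O * XO * C01 - O ^ 2 * Cc + O * XO * Dd + (O * A - XO * Hh) * (wO + YO)) +
        t ^ 2 * (1 - t) * (O * A - XO * Hh) * Nz * Z2O * (Sz * YO - O * YSz) := by
    have hSzNz : 0 ≤ Sz * Nz := by positivity
    refine add_nonneg (add_nonneg (add_nonneg ?_ ?_) ?_) ?_
    · exact mul_nonneg (mul_nonneg (mul_nonneg (mul_nonneg ht1' hSzNz) hNd) hSv) hbase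
    · exact mul_nonneg (mul_nonneg (mul_nonneg (mul_nonneg (by positivity) hO.le) hNz.le) hSv) H1
    · exact mul_nonneg (mul_nonneg (mul_nonneg (mul_nonneg ht0 ht1') hSv) hSzNz) H2T
    · exact mul_nonneg (mul_nonneg (mul_nonneg (mul_nonneg (mul_nonneg (by positivity) ht1') hK)
        hNz.le) hZ2O) hD
  have hpos : 0 < O * Sz * Nz := by positivity
  rw [← key] at hrhs
  exact nonneg_of_mul_nonneg_right hrhs hpos

end PendantCoreT

end KPrime

end Summit.Ventures.PercRepro2
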